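import Mathlib.LinearAlgebra.Matrix.Block
import Mathlib.LinearAlgebra.Matrix.Determinant.Basic
import Mathlib.LinearAlgebra.Matrix.BilinearForm
import Mathlib.LinearAlgebra.Matrix.NonsingularInverse
import Mathlib.LinearAlgebra.BilinearForm.Properties
import Mathlib.LinearAlgebra.Basis.Fin
import Mathlib.LinearAlgebra.FreeModule.PID
import Mathlib.LinearAlgebra.Dimension.StrongRankCondition
import Mathlib.RingTheory.Ideal.Operations
import Mathlib.RingTheory.PrincipalIdealDomain
import Mathlib.Data.Int.Bitwise
import HarnessLib

/-!
# Hermite's bound for the minimum of an integral quadratic form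

Topic `NumberTheory/QuadraticForms`; namespace `Literature.NumberTheory.QuadraticForms`. Everything
here is proved; only Mathlib is used.

**Hermite's inequality** (Hermite 1850; Cassels, *An Introduction to the Geometry of Numbers*,
Ch. II §3.2 Thm. I): a non-singular quadratic form `f(x) = ∑ fᵢⱼ xᵢ xⱼ` in `n` variables
represents a value `f(u)`, `u ≠ 0` integral, with `|f(u)| ≤ (4/3)^{(n-1)/2} |D|^{1/n}`,
`D = det(fᵢⱼ)`. We prove it for **integral** symmetric bilinear forms `B` on a free `ℤ`-module
`M` of rank `n` (Gram matrix `Bᵢⱼ = B(bᵢ, bⱼ)` in a basis `b`), in the equivalent integer form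

  `3^{n(n-1)/2} · m^n ≤ 4^{n(n-1)/2} · |det (Bᵢⱼ)|`     (`hermite_bound`)

for every `m` with `m ≤ |B(v, v)|` for all `v ≠ 0`, when `B` is *anisotropic* (`B(v,v) ≠ 0` for
`v ≠ 0`); hence (`exists_ne_zero_natAbs_pow_le`) every symmetric integral form of rank `n ≥ 1`
has a vector `u ≠ 0` with `3^{n(n-1)/2} |B(u,u)|^n ≤ 4^{n(n-1)/2} |det|` — Cassels' statement
raised to the `n`-th power (for an isotropic `u` the left side is `0`; singular forms, `det = 0`,
are isotropic over `ℤ`, so no non-singularity hypothesis is needed in this form).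

The proof is Hermite's own reduction argument (Cassels, proof of Thm. I, there run for definite
forms and transferred to indefinite ones by a majorant; for an anisotropic integral form the
induction goes through verbatim since `|B(v,v)|` attains a positive minimum): let `x` minimise
`|B(v,v)| = |a|` over `v ≠ 0`. Then `x` is primitive, so `M = ℤx ⊕ K` with `K = ker f` for a
linear form `f` with `f(x) = 1` (`exists_dual_eq_one_of_forall_natAbs_le`); on `K` the integral
form `B₁(y, z) = a B(y,z) - B(x,y) B(x,z)` (`= a ×` the projection of `B` to `x^⊥`) has Gram
determinant `det B₁ = a^{n-2} det B` (`det_corner_mul_det_schur`, the Schur complement of the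
corner `a`) and satisfies `4 |B₁(y,y)| ≥ 3 a²` for `y ≠ 0` (`three_mul_sq_le`: writing
`B(x,y) = q a + r` with `|2r| ≤ |a|`, `a B(y - qx, y - qx) = B₁(y,y) + r²` and
`|B(y - qx, y - qx)| ≥ |a|`); induction on `n`.

Design: the canonical `ℤ`-module structure (`[AddCommGroup M]` only) is used throughout, as in
`Literature/Topology/FourManifolds/LatticeForms*.lean`; exponents `n(n-1)/2` are written
`n.choose 2`; absolute values of integers as `Int.natAbs`, so that all inequalities live in `ℕ`.
The application to unimodular lattices of rank `≤ 5` (a vector of square `0` or `±1`, whence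
Serre's Theorem V.3 in these ranks) is in
`Literature/Topology/FourManifolds/LatticeFormsAnisotropic.lean`.

## References

* J. W. S. Cassels, *An Introduction to the Geometry of Numbers*, Classics in Mathematics,
  Springer 1997 (reprint of the 1971 edition), Ch. II §2.2, §3.2 Thm. I (PDF pp. 29–31 of the
  held copy). [Cassels1997]
* Ch. Hermite, Lettres à M. Jacobi …, J. reine angew. Math. 40 (1850), 261–315 (first letter).
-/

open Module Matrix
open LinearMap (BilinForm)

namespace Literature.NumberTheory.QuadraticForms

universe u

/-! ### The Schur complement of a corner entry -/

/-- **Determinant of the integral Schur complement of a corner.** For a square matrix `A` of size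
`n + 1` over a commutative ring with corner `a = A 0 0`, the matrix
`C i j = a · A (i+1) (j+1) - A (i+1) 0 · A 0 (j+1)` (which is `a` times the Schur complement of
the corner when `a` is invertible) satisfies `a · det C = aⁿ · det A`: multiply the rows
`1, …, n` of `A` by `a` and subtract `A (i+1) 0` times row `0` — a lower triangular operation of
determinant `aⁿ` — then expand along column `0`. [folklore] -/
theorem det_corner_mul_det_schur {R : Type*} [CommRing R] {n : ℕ}
    (A : Matrix (Fin (n + 1)) (Fin (n + 1)) R) :
    A 0 0 * (Matrix.of fun i j : Fin n => A 0 0 * A i.succ j.succ - A i.succ 0 * A 0 j.succ).det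
      = A 0 0 ^ n * A.det := by
  set a := A 0 0 with ha
  -- the row operations: scale rows `1..n` by `a`, then clear column `0` below the corner
  let L : Matrix (Fin (n + 1)) (Fin (n + 1)) R := Matrix.of fun i j =>
    if i = 0 then (if j = 0 then 1 else 0) else if j = 0 then -A i 0 else if i = j then a else 0
  let A' : Matrix (Fin (n + 1)) (Fin (n + 1)) R := Matrix.of fun i j =>
    if i = 0 then A 0 j else a * A i j - A i 0 * A 0 j
  have hLA : L * A = A' := by
    ext i j
    rw [Matrix.mul_apply, Fin.sum_univ_succ]
    by_cases hi : i = 0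
    · subst hi
      simp [L, A', Fin.succ_ne_zero]
    · simp only [L, A', Matrix.of_apply, if_neg hi, Fin.succ_ne_zero, if_false, if_true]
      have : ∑ x : Fin n, (if i = x.succ then a else 0) * A x.succ j = a * A i j := by
        obtain ⟨i', rfl⟩ := Fin.exists_succ_eq.mpr hi
        simp [Fin.succ_inj]
      rw [this]
      ring
  have hdetL : L.det = a ^ n := by
    have htri : L.BlockTriangular OrderDual.toDual := by
      intro i j hij
      have hij' : i < j := hij
      simp only [L, Matrix.of_apply]
      by_cases hi : i = 0
      · subst hi
        simp [hij'.ne']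
      · rw [if_neg hi, if_neg (fun hj => by simp [hj] at hij'), if_neg hij'.ne]
    rw [Matrix.det_of_lowerTriangular L htri, Fin.prod_univ_succ]
    simp [L, Fin.succ_ne_zero]
  have hdetA' : A'.det = a * (Matrix.of fun i j : Fin n =>
      a * A i.succ j.succ - A i.succ 0 * A 0 j.succ).det := by
    rw [Matrix.det_succ_column_zero, Fin.sum_univ_succ]
    have h0 : ∀ i : Fin n, A' i.succ 0 = 0 := fun i => by
      simp [A', Fin.succ_ne_zero]; ring
    simp only [h0, mul_zero, zero_mul, Finset.sum_const_zero, add_zero, Fin.val_zero, pow_zero,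
      one_mul, Fin.succAbove_zero]
    rfl
  calc a * (Matrix.of fun i j : Fin n => a * A i.succ j.succ - A i.succ 0 * A 0 j.succ).det
      = A'.det := hdetA'.symm
    _ = (L * A).det := by rw [hLA]
    _ = a ^ n * A.det := by rw [Matrix.det_mul, hdetL]

/-! ### Gram determinants, minimal vectors, primitivity -/

variable {M : Type u} [AddCommGroup M]

/-- The absolute value of the Gram determinant `|det (B(bᵢ, bⱼ))|` of an integral bilinear form
does not depend on the basis `b` (two bases differ by a matrix of determinant `±1`).
[folklore] -/
theorem natAbs_det_toMatrix_eq {ι : Type*} [Fintype ι] [DecidableEq ι] (b c : Basis ι ℤ M)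
    (B : BilinForm ℤ M) :
    (LinearMap.BilinForm.toMatrix c B).det.natAbs
      = (LinearMap.BilinForm.toMatrix b B).det.natAbs := by
  rw [← LinearMap.BilinForm.toMatrix_mul_basis_toMatrix b c B, Matrix.det_mul, Matrix.det_mul,
    Matrix.det_transpose, Int.natAbs_mul, Int.natAbs_mul]
  have hu : IsUnit (b.toMatrix c).det :=
    Matrix.isUnit_det_of_right_inverse (b.toMatrix_mul_toMatrix_flip c)
  rw [Int.isUnit_iff_natAbs_eq] at hu
  rw [hu, one_mul, mul_one]

/-- **Minimal vectors exist**: an integral form on a nonzero lattice has a vector `x ≠ 0`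
minimising `|B(v, v)|` over all `v ≠ 0` (the values are natural numbers).
(Cassels, Ch. II §2.2: "we may find an integral `e₁' ≠ 0` such that `|f(e₁')|`" is minimal.)
[folklore] -/
theorem exists_forall_natAbs_le {n : ℕ} (b : Basis (Fin (n + 1)) ℤ M) (B : BilinForm ℤ M) :
    ∃ x : M, x ≠ 0 ∧ ∀ v : M, v ≠ 0 → (B x x).natAbs ≤ (B v v).natAbs := by
  classical
  have hne : ∃ k : ℕ, ∃ v : M, v ≠ 0 ∧ (B v v).natAbs = k := ⟨_, b 0, b.ne_zero 0, rfl⟩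
  obtain ⟨x, hx0, hx⟩ := Nat.find_spec hne
  exact ⟨x, hx0, fun v hv => hx ▸ Nat.find_min' hne ⟨v, hv, rfl⟩⟩

/-- **A minimal vector of an anisotropic form is primitive**: if `x ≠ 0` minimises `|B(v,v)|`
over `v ≠ 0` and `B` is anisotropic, some linear form `f : M → ℤ` has `f x = 1` (so that
`M = ℤ x ⊕ ker f`). Indeed the coordinates of `x` generate a principal ideal `(g)`, `x = g • y`,
and `|B(x,x)| = g² |B(y,y)| ≤ |B(y,y)| ≠ 0` forces `g = ±1` (Cassels, Ch. II §2.2: "If `e₁'`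
were of the shape `e₁' = k a`, `k > 1`, we should have `0 < f(a) = k^{-r} f(e₁') < f(e₁')`";
and Ch. I Thm. I Cor. 3: a primitive vector extends to a basis). [folklore] -/
theorem exists_dual_eq_one_of_forall_natAbs_le {ι : Type*} [Fintype ι] (b : Basis ι ℤ M)
    {B : BilinForm ℤ M} (han : ∀ v : M, v ≠ 0 → B v v ≠ 0) {x : M} (hx0 : x ≠ 0)
    (hmin : ∀ v : M, v ≠ 0 → (B x x).natAbs ≤ (B v v).natAbs) :
    ∃ f : M →ₗ[ℤ] ℤ, f x = 1 := by
  classical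
  -- the ideal generated by the coordinates of `x` is principal, say generated by `g`
  set c : ι → ℤ := fun i => b.repr x i with hc
  set I : Ideal ℤ := Ideal.span (Set.range c) with hI
  set g : ℤ := Submodule.IsPrincipal.generator I with hg
  have hIg : I = Ideal.span {g} := (Ideal.span_singleton_generator I).symm
  -- `g = ∑ uᵢ cᵢ`
  have hgmem : g ∈ I := Submodule.IsPrincipal.generator_mem I
  obtain ⟨u, hu⟩ := Ideal.mem_span_range_iff_exists_fun.mp hgmem
  have hdvd : ∀ i, g ∣ c i := fun i => by
    rw [← Ideal.mem_span_singleton, ← hIg]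
    exact Ideal.subset_span ⟨i, rfl⟩
  -- the linear form `f = ∑ uᵢ coordᵢ` has `f x = g`
  let f : M →ₗ[ℤ] ℤ := ∑ i, u i • b.coord i
  have hfx : f x = g := by
    simp only [f, LinearMap.coe_sum, Finset.sum_apply, LinearMap.smul_apply, Basis.coord_apply,
      smul_eq_mul]
    exact hu
  -- `x = g • y`
  let y : M := ∑ i, (c i / g) • b i
  have hxy : x = g • y := by
    show x = g • ∑ i, (c i / g) • b i
    rw [Finset.smul_sum]
    simp_rw [smul_smul]
    conv_lhs => rw [← b.sum_repr x]
    refine Finset.sum_congr rfl fun i _ => ?_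
    rw [Int.mul_ediv_cancel' (hdvd i)]
  have hy0 : y ≠ 0 := by
    rintro hy
    rw [hy, smul_zero] at hxy
    exact hx0 hxy
  -- minimality forces `g² ≤ 1`
  have hle := hmin y hy0
  rw [hxy, LinearMap.BilinForm.smul_left, LinearMap.BilinForm.smul_right, Int.natAbs_mul,
    Int.natAbs_mul] at hle
  have hByy : 0 < (B y y).natAbs := Int.natAbs_pos.mpr (han y hy0)
  have hg1 : g.natAbs * g.natAbs ≤ 1 := by
    have : g.natAbs * g.natAbs * (B y y).natAbs ≤ 1 * (B y y).natAbs := by linarith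
    exact Nat.le_of_mul_le_mul_right this hByy
  have hg0 : g ≠ 0 := fun h0 => hx0 (by rw [hxy, h0, zero_smul])
  have hgabs : g.natAbs = 1 := by
    have := Int.natAbs_pos.mpr hg0
    nlinarith
  refine ⟨g • f, ?_⟩
  rw [LinearMap.smul_apply, hfx, smul_eq_mul, ← sq, ← Int.natAbs_sq g, hgabs]
  norm_num

/-! ### The reduction step -/

/-- Balanced division with remainder: for `a ≠ 0`, every integer is `q a + r` with `|2r| ≤ |a|`
(Mathlib's `Int.bdiv`/`Int.bmod`). [folklore] -/
theorem exists_eq_mul_add_of_ne_zero {a : ℤ} (ha : a ≠ 0) (t : ℤ) :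
    ∃ q r : ℤ, t = q * a + r ∧ 2 * r.natAbs ≤ a.natAbs := by
  have hα : 0 < a.natAbs := Int.natAbs_pos.mpr ha
  have hdecomp := Int.bdiv_add_bmod t a.natAbs
  have hlo := Int.le_bmod (x := t) hα
  have hhi := Int.bmod_lt (x := t) hα
  have hr : 2 * (Int.bmod t a.natAbs).natAbs ≤ a.natAbs := by omega
  rcases Int.natAbs_eq a with h | h
  · refine ⟨Int.bdiv t a.natAbs, Int.bmod t a.natAbs, ?_, hr⟩
    rw [← h] at hdecomp
    linarith
  · refine ⟨-Int.bdiv t a.natAbs, Int.bmod t a.natAbs, ?_, hr⟩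
    have : (a.natAbs : ℤ) = -a := by omega
    rw [this] at hdecomp
    linarith

/-- **The key inequality of Hermite's reduction** (Cassels, Ch. II §3.2, proof of Thm. I:
"`f₁₁ ≤ f(u) ≤ f₁₁/4 + g(u₂, …, uₙ)`", in its anisotropic integral form). Let `B` be symmetric,
`f` a linear form with `f x = 1`, and suppose `a = B(x,x) ≠ 0` and `|B(x,x)| ≤ |B(v,v)|` for all
`v ≠ 0`. Then for every `y ≠ 0` with `f y = 0`,
`3 · B(x,x)² ≤ 4 · |a B(y,y) - B(x,y)²|`: write `B(x,y) = q a + r` with `|2r| ≤ |a|` and put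
`z = y - q x ≠ 0`; then `a B(z,z) = (a B(y,y) - B(x,y)²) + r²` and `|B(z,z)| ≥ |a|`.
[cite: Cassels1997, Ch. II §3.2 Thm. I] -/
theorem three_mul_sq_le {B : BilinForm ℤ M} (hB : B.IsSymm) {x : M} {f : M →ₗ[ℤ] ℤ}
    (hfx : f x = 1) (hmin : ∀ v : M, v ≠ 0 → (B x x).natAbs ≤ (B v v).natAbs) (hx : B x x ≠ 0)
    {y : M} (hy : f y = 0) (hy0 : y ≠ 0) :
    3 * (B x x).natAbs ^ 2 ≤ 4 * (B x x * B y y - B x y * B x y).natAbs := by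
  set a := B x x with ha
  set t := B x y with ht
  obtain ⟨q, r, hqr, hr⟩ := exists_eq_mul_add_of_ne_zero hx t
  -- the test vector `z = y - q • x`
  set z : M := y - q • x with hz
  have hz0 : z ≠ 0 := by
    intro h0
    have hyq : y = q • x := sub_eq_zero.mp h0
    have : f y = q := by rw [hyq, map_zsmul, hfx, smul_eq_mul, mul_one]
    rw [hy] at this
    rw [← this, zero_smul] at hyq
    exact hy0 hyq
  have hmz := hmin z hz0
  -- `a * B z z = (a * B y y - t²) + r²`
  have htx : B y x = t := by rw [ht, hB.eq]
  have hid : a * B y y - t * t = a * B z z - r * r := by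
    have hBzz : B z z = B y y - q * t - q * t + q * q * a := by
      simp only [hz, LinearMap.BilinForm.sub_left, LinearMap.BilinForm.sub_right,
        LinearMap.BilinForm.smul_left, LinearMap.BilinForm.smul_right, htx, ← ht, ← ha]
      ring
    rw [hBzz, hqr]
    ring
  rw [hid]
  have hmz' : |a| ≤ |B z z| := by
    rw [Int.abs_eq_natAbs, Int.abs_eq_natAbs]
    exact_mod_cast hmz
  have h1 : |a| * |a| ≤ |a * B z z| := by
    rw [abs_mul]
    exact mul_le_mul_of_nonneg_left hmz' (abs_nonneg a)
  have hr' : 2 * |r| ≤ |a| := by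
    rw [Int.abs_eq_natAbs, Int.abs_eq_natAbs]
    exact_mod_cast hr
  have h2 : (4 : ℤ) * (r * r) ≤ |a| * |a| := by
    have h := mul_self_le_mul_self (by positivity) hr'
    have hrr : |r| * |r| = r * r := abs_mul_abs_self r
    nlinarith
  have h3 : |a * B z z| - |r * r| ≤ |a * B z z - r * r| := abs_sub_abs_le_abs_sub _ _
  have h4 : |r * r| = r * r := abs_mul_self r
  have key : 3 * (|a| * |a|) ≤ 4 * |a * B z z - r * r| := by linarith
  have : ((3 * a.natAbs ^ 2 : ℕ) : ℤ) ≤ ((4 * (a * B z z - r * r).natAbs : ℕ) : ℤ) := by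
    push_cast
    rw [sq]
    exact key
  exact_mod_cast this

/-! ### Hermite's inequality -/

/-- **Hermite's inequality** (Cassels, *An Introduction to the Geometry of Numbers*, Ch. II §3.2
Thm. I, for anisotropic integral forms): let `B` be a symmetric bilinear form on a free `ℤ`-module
with basis `b : Fin n → M`, with `B(v, v) ≠ 0` for all `v ≠ 0`, and let `m ≤ |B(v, v)|` for
all `v ≠ 0`. Then `3^{n(n-1)/2} mⁿ ≤ 4^{n(n-1)/2} |det (B(bᵢ, bⱼ))|`, i.e.
`m ≤ (4/3)^{(n-1)/2} |D|^{1/n}`. Proof by Hermite's reduction (file header): a primitive minimal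
vector `x`, `a = B(x,x)`, the form `B₁ = a B - B(x,·) ⊗ B(x,·)` on a complement `K = ker f` of
`ℤx`, `det B₁ = a^{n-2} det B` (`det_corner_mul_det_schur`) and `4 |B₁(y,y)| ≥ 3a²`
(`three_mul_sq_le`), and induction. [cite: Cassels1997, Ch. II §3.2 Thm. I] -/
theorem hermite_bound (n : ℕ) :
    ∀ {M : Type u} [AddCommGroup M] (b : Basis (Fin n) ℤ M) (B : BilinForm ℤ M), B.IsSymm →
      (∀ v : M, v ≠ 0 → B v v ≠ 0) → ∀ m : ℕ, (∀ v : M, v ≠ 0 → m ≤ (B v v).natAbs) →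
      3 ^ n.choose 2 * m ^ n ≤ 4 ^ n.choose 2 * (LinearMap.BilinForm.toMatrix b B).det.natAbs := by
  induction n with
  | zero =>
    intro M _ b B _ _ m _
    simp [Matrix.det_isEmpty]
  | succ n ih =>
    intro M _ b B hB han m hm
    classical
    -- a minimal vector `x`, `a = B x x ≠ 0`
    obtain ⟨x, hx0, hmin⟩ := exists_forall_natAbs_le b B
    set a := B x x with ha
    have hax : a ≠ 0 := han x hx0
    have hα : 0 < a.natAbs := Int.natAbs_pos.mpr hax
    have hmα : m ≤ a.natAbs := hm x hx0
    -- `x` is primitive: `f x = 1`, and `M = ℤ x ⊕ ker f`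
    obtain ⟨f, hfx⟩ := exists_dual_eq_one_of_forall_natAbs_le b han hx0 hmin
    set K : Submodule ℤ M := LinearMap.ker f with hK
    obtain ⟨k, bK⟩ := Submodule.basisOfPid b K
    have hli : ∀ (c : ℤ), ∀ y ∈ K, c • x + y = 0 → c = 0 := fun c y hy h => by
      simpa [hfx, LinearMap.mem_ker.mp hy] using congrArg f h
    have hsp : ∀ z : M, ∃ c : ℤ, z + c • x ∈ K := fun z => ⟨-f z, by simp [hK, hfx]⟩
    let bM : Basis (Fin (k + 1)) ℤ M := Basis.mkFinCons x bK hli hsp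
    -- hence `k = n`
    have hk : n = k := by
      have := Fintype.card_congr (bM.indexEquiv b)
      simp only [Fintype.card_fin] at this
      omega
    subst hk
    have hbM0 : bM 0 = x := by simp [bM]
    have hbMs : ∀ i : Fin n, bM i.succ = bK i := fun i => by simp [bM]
    -- the reduced form `B₁ = a • B|K - (B x ·)²` on `K`
    let φ : K →ₗ[ℤ] ℤ := (B x).comp K.subtype
    let B₁ : BilinForm ℤ K := a • B.restrict K - (LinearMap.mul ℤ ℤ).compl₁₂ φ φ
    have hB₁ : ∀ y z : K, B₁ y z = a * B y z - B x y * B x z := fun y z => rfl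
    have hB₁s : B₁.IsSymm := ⟨fun y z => by rw [hB₁, hB₁, hB.eq (y : M) z, mul_comm (B x y)]⟩
    -- the key inequality `3 a² ≤ 4 |B₁ y y|` for `y ≠ 0`
    have hkey : ∀ y : K, y ≠ 0 → 3 * a.natAbs ^ 2 ≤ 4 * (B₁ y y).natAbs := by
      intro y hy0
      rw [hB₁]
      exact three_mul_sq_le hB hfx hmin hax (LinearMap.mem_ker.mp y.2)
        (fun h => hy0 (Subtype.ext h))
    have han₁ : ∀ y : K, y ≠ 0 → B₁ y y ≠ 0 := fun y hy0 h0 => by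
      have h := hkey y hy0
      rw [h0, Int.natAbs_zero, mul_zero] at h
      have : 0 < a.natAbs ^ 2 := by positivity
      omega
    -- induction hypothesis for `B₁` with the bound `m₁ = ⌈3a²/4⌉`
    set m₁ : ℕ := (3 * a.natAbs ^ 2 + 3) / 4 with hm₁
    have hm₁le : ∀ y : K, y ≠ 0 → m₁ ≤ (B₁ y y).natAbs := fun y hy0 => by
      have := hkey y hy0
      omega
    have hm₁ge : 3 * a.natAbs ^ 2 ≤ 4 * m₁ := by omega
    have IH := ih bK B₁ hB₁s han₁ m₁ hm₁le
    -- the determinants: `a * det C = a ^ n * det A`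
    set A := LinearMap.BilinForm.toMatrix bM B with hA
    have hA00 : A 0 0 = a := by rw [hA, LinearMap.BilinForm.toMatrix_apply, hbM0]
    have hC : LinearMap.BilinForm.toMatrix bK B₁ =
        Matrix.of (fun i j : Fin n => A 0 0 * A i.succ j.succ - A i.succ 0 * A 0 j.succ) := by
      ext i j
      rw [LinearMap.BilinForm.toMatrix_apply, hB₁, Matrix.of_apply, hA00]
      simp only [hA, LinearMap.BilinForm.toMatrix_apply, hbM0, hbMs]
      rw [hB.eq (bK i : M) x]
    have hdet : a.natAbs * (LinearMap.BilinForm.toMatrix bK B₁).det.natAbs =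
        a.natAbs ^ n * A.det.natAbs := by
      have h := congrArg Int.natAbs (det_corner_mul_det_schur A)
      rwa [← hC, hA00, Int.natAbs_mul, Int.natAbs_mul, Int.natAbs_pow] at h
    have hdetb : (LinearMap.BilinForm.toMatrix b B).det.natAbs = A.det.natAbs :=
      natAbs_det_toMatrix_eq bM b B
    rw [hdetb, Nat.choose_succ_succ, Nat.choose_one_right]
    set c := n.choose 2
    set α := a.natAbs
    set D := A.det.natAbs
    set D₁ := (LinearMap.BilinForm.toMatrix bK B₁).det.natAbs
    -- from `IH : 3 ^ c * m₁ ^ n ≤ 4 ^ c * D₁`, `hm₁ge`, `hdet : α * D₁ = α ^ n * D`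
    have h2 : 3 ^ (n + c) * α ^ (n + 1) * α ^ n ≤ 4 ^ (n + c) * D * α ^ n := by
      calc 3 ^ (n + c) * α ^ (n + 1) * α ^ n = 3 ^ c * (3 * α ^ 2) ^ n * α := by ring
        _ ≤ 3 ^ c * (4 * m₁) ^ n * α := by gcongr
        _ = 4 ^ n * α * (3 ^ c * m₁ ^ n) := by ring
        _ ≤ 4 ^ n * α * (4 ^ c * D₁) := by gcongr
        _ = 4 ^ (n + c) * (α * D₁) := by ring
        _ = 4 ^ (n + c) * D * α ^ n := by rw [hdet]; ring
    have h3 : 3 ^ (n + c) * α ^ (n + 1) ≤ 4 ^ (n + c) * D :=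
      Nat.le_of_mul_le_mul_right h2 (pow_pos hα n)
    calc 3 ^ (n + c) * m ^ (n + 1) ≤ 3 ^ (n + c) * α ^ (n + 1) := by gcongr
      _ ≤ 4 ^ (n + c) * D := h3

/-- **Hermite's inequality, Cassels' form for integral forms**: a symmetric integral bilinear
form on a free `ℤ`-module of rank `n ≥ 1` with basis `b` represents a value `B(u,u)`, `u ≠ 0`,
with `3^{n(n-1)/2} |B(u,u)|ⁿ ≤ 4^{n(n-1)/2} |det (B(bᵢ,bⱼ))|`, i.e.
`|B(u,u)| ≤ (4/3)^{(n-1)/2} |D|^{1/n}` (Cassels, Ch. II §3.2 Thm. I; if `B` has an isotropic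
vector the left-hand side vanishes, otherwise take a minimal vector in `hermite_bound`).
[cite: Cassels1997, Ch. II §3.2 Thm. I] -/
theorem exists_ne_zero_natAbs_pow_le {n : ℕ} (b : Basis (Fin (n + 1)) ℤ M) {B : BilinForm ℤ M}
    (hB : B.IsSymm) :
    ∃ u : M, u ≠ 0 ∧ 3 ^ (n + 1).choose 2 * (B u u).natAbs ^ (n + 1)
      ≤ 4 ^ (n + 1).choose 2 * (LinearMap.BilinForm.toMatrix b B).det.natAbs := by
  by_cases han : ∀ v : M, v ≠ 0 → B v v ≠ 0
  · obtain ⟨x, hx0, hmin⟩ := exists_forall_natAbs_le b B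
    exact ⟨x, hx0, hermite_bound (n + 1) b B hB han _ hmin⟩
  · push Not at han
    obtain ⟨v, hv0, hv⟩ := han
    exact ⟨v, hv0, by simp [hv]⟩

end Literature.NumberTheory.QuadraticForms
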